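import Mathlib
import HarnessLib
import Summits.HubbardSuperconductivity.HubbardSuperconductivity.Theorems.KLProgrammeKLRegimeEngineRowBPlainLineOfMomentumRep

/-!
# Route `KLProgramme` — crux K3 ENGINE (stmt-HubbardSuperconductivity-20437 `KLRegimeEngineV17F2`), registration V2 (α1) image 27cd7ed0f55f17c0,
# ROW (b) `stub_engine_step_norms` (digest e78dfb33d2f7), binder #5 `hE₁` BY TYPE: the (E2) ∧ (E4) ∧ (E6) interface SPLIT into three independent
# families, and its (E4) conjunct — the `klScaleWt_i`-weighted PLAIN quartic line of `𝒱_i[Kₙ]` at EVERY level `i ≤ n` (ε-currency) — FROM MOMENTUM-SPACE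
# PAIR-TRANSFER REPRESENTATIONS of the `↑↓` channel, level by level (cell gate-hubbard-kl, seat p3 g25)

`hE₁` (E1-LEDGER §1 #5, «(E2) ℛ-decay 3–5 · (E4) 1–2 · (E6) 1–2») is ONE hypothesis family binding four constants `s₂u s₂c s₄ S₆` and two doors `cE UE` over the
conjunction of three row families with different suppliers ((E2): renormalised two-leg decay; (E4): the sign-blind quartic line; (E6): the six-leg law).  This file:

* §1 **`hE₁_of_split`** — three families `hE2`, `hE4`, `hE6`, each with its OWN constants and doors under the SAME binders, give `hE₁` verbatim (doors by `min`);
* §2 **`hE4_of_momRepLevels`** — the (E4) family from a LEVEL-BY-LEVEL momentum-representation family `hE4mom`: at every level `1 ≤ i ≤ n` the degree-4 momentum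
  kernel of `𝒱_i[Kₙ] = klEffectiveAction … (klFlowFrameU … n) klE0 i` on the Cooper pattern is a superposition of conserving transfer bumps ((T1w) data at rates
  `≥ (Λ_iβ/(2M), Λ_i)`) plus a remainder with weighted line `r`, closing as `2·(…) ≤ s₄·ε_i` — one call of
  `wplainLine_klEffectiveAction_allStrings_of_momentumRepresentation` (p736868) at `(K, e₀, n, j) := (Kₙ, klE0, i, i)` per level;
* §3 the capstone **`A24a1G14.stub_engine_step_norms_of_E1data₅ hE2 hE4mom hE6 ha hb hu₀ hmomRep hincr`** ⊢ row (b) verbatim (`…_of_E1data₄` ∘ §1 ∘ §2).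
So after this file row (b) is, BY NAME, a consequence of FIVE independent E1-class families — (E2) two-leg input cells, (E6) six-leg input cells, the two
momentum-representation families (`hE4mom`: every level, ε-currency; `hmomRep`: top level, U-currency — ONE producer object read twice) and `hincr` — plus the
numerics `a bfun u₀`.  Everything is proved; no definitions; nothing asserts any family, row (b), any stub of 20437, K3, U₀, the window or superconductivity.
References: BGM 2006 §2.3 (2.17), (2.41a), §2.5–§2.8 (2.52)–(2.84), Lemma 2.5 (2.98), §3 (3.2)–(3.8) [cite: BenfattoGiulianiMastropietro2006].
-/

noncomputable section

namespace Summit.HubbardSuperconductivity.HubbardSuperconductivity.Theorems.EngineV8.A24a1G14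

set_option linter.dupNamespace false -- summit = problem name (single-conjunct summit), D-0017

open Classical
open Real Finset Literature.MathematicalPhysics.QuantumLattice Literature.Probability.LatticeModels GrassmannAlgebra
open Literature.MathematicalPhysics.QuantumLattice.FermiRG
open Summit.HubbardSuperconductivity.HubbardSuperconductivity.Theorems.KLProgrammeLegKernels
open Summit.HubbardSuperconductivity.HubbardSuperconductivity.Theorems.KLRegimeSplit
open Summit.HubbardSuperconductivity.HubbardSuperconductivity.Theorems.DispersionFlow
open Summit.HubbardSuperconductivity.HubbardSuperconductivity.Theorems.EngineV8

/-! ## §1 The split -/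

/-- **`hE₁` FROM THREE INDEPENDENT FAMILIES** — (E2) two-leg input cells (`s₂u, s₂c`), (E4) weighted plain quartic lines at every level (`s₄`), (E6) six-leg input cells
(`S₆`), each with its own doors `cE, UE` under the binders of `hE₁`; the joint doors are the minima. Pure logic. -/
theorem hE₁_of_split
    (hE2 : ∀ (P : SplitConsts) (R : RenConsts), P.WF → R.WF2 →
      ∃ s₂u s₂c : ℝ, 0 ≤ s₂u ∧ 0 ≤ s₂c ∧ ∃ cE UE : ℝ, 0 < cE ∧ 0 < UE ∧
      ∀ (Q : EngConsts) (cc : ℝ), 0 < cc → cc ≤ klEngC₃6 P R → cc ≤ cE →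
      ∀ μ ∈ klWindowC, ∀ U : ℝ, 0 < U → U ≤ klEngU₀10 P R cc → U ≤ UE →
      ∀ β : ℝ, klBetaMin ≤ β → β ≤ Real.exp (cc / U ^ 2) →
      ∀ (L M : ℕ) [NeZero L] [NeZero M], klEngL₄ P R β U ≤ L → klEngM₃ β U L ≤ M →
      ∀ n : ℕ, 1 ≤ n → n ≤ nScales β + 1 → IsKLRegime U cc (-(n : ℤ)) →
      HistP klPredsV17F2 L M klEngGeo14 P Q R β U μ 0 n →
      (∀ m, 1 ≤ m → m < n → FlowPieceOscAt L M (klReadOscC P R) β U μ m) →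
      FrameOK R U (nScales β) μ (klFlowFrameU L M β U μ n) →
      (∀ j ≤ n, LevelsUExportMixedAt L M (klCU2 P R (klEngQ7 P R)) P β U μ j) →
      ∀ i, 1 ≤ i → i ≤ n → ∀ (q : Fin 2) (w : SpaceTimeIdx L M × SectorLeg (sectorCount (i - 1))),
        klWtPinnedSumOf L M β μ (klFlowFrameU L M β U μ n) (i - 1) 2 (klEffectiveAction L M β U μ (klFlowFrameU L M β U μ n) klE0 i) q w ≤
          (s₂u * |U| + s₂c * cc) * ((4 : ℝ) ^ (i - 1))⁻¹)
    (hE4 : ∀ (P : SplitConsts) (R : RenConsts), P.WF → R.WF2 →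
      ∃ s₄ : ℝ, 0 ≤ s₄ ∧ ∃ cE UE : ℝ, 0 < cE ∧ 0 < UE ∧
      ∀ (Q : EngConsts) (cc : ℝ), 0 < cc → cc ≤ klEngC₃6 P R → cc ≤ cE →
      ∀ μ ∈ klWindowC, ∀ U : ℝ, 0 < U → U ≤ klEngU₀10 P R cc → U ≤ UE →
      ∀ β : ℝ, klBetaMin ≤ β → β ≤ Real.exp (cc / U ^ 2) →
      ∀ (L M : ℕ) [NeZero L] [NeZero M], klEngL₄ P R β U ≤ L → klEngM₃ β U L ≤ M →
      ∀ n : ℕ, 1 ≤ n → n ≤ nScales β + 1 → IsKLRegime U cc (-(n : ℤ)) →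
      HistP klPredsV17F2 L M klEngGeo14 P Q R β U μ 0 n →
      (∀ m, 1 ≤ m → m < n → FlowPieceOscAt L M (klReadOscC P R) β U μ m) →
      FrameOK R U (nScales β) μ (klFlowFrameU L M β U μ n) →
      (∀ j ≤ n, LevelsUExportMixedAt L M (klCU2 P R (klEngQ7 P R)) P β U μ j) →
      ∀ i, 1 ≤ i → i ≤ n → ∀ (q : Fin 4) (τ' : Fin 4 → SectorLeg 1) (y' : SpaceTimeIdx L M),
        imagTimeWeight β M ^ 3 * ∑ x' ∈ univ.filter (fun x' : Fin 4 → SpaceTimeIdx L M => x' q = y'),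
          klScaleWt L M β i ((univ.image x').image (fun x : SpaceTimeIdx L M => (((((2 * (x.1 : ℕ) : ℕ)) : ZMod (2 * (2 * M)))), x.2))) *
            ‖sectorisedKernel L M β (trivialMultiplier L M) (klEffectiveAction L M β U μ (klFlowFrameU L M β U μ n) klE0 i) 4 τ' x'‖ ≤ s₄ * epsCoupling P U i)
    (hE6 : ∀ (P : SplitConsts) (R : RenConsts), P.WF → R.WF2 →
      ∃ S₆ : ℝ, 0 ≤ S₆ ∧ ∃ cE UE : ℝ, 0 < cE ∧ 0 < UE ∧
      ∀ (Q : EngConsts) (cc : ℝ), 0 < cc → cc ≤ klEngC₃6 P R → cc ≤ cE →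
      ∀ μ ∈ klWindowC, ∀ U : ℝ, 0 < U → U ≤ klEngU₀10 P R cc → U ≤ UE →
      ∀ β : ℝ, klBetaMin ≤ β → β ≤ Real.exp (cc / U ^ 2) →
      ∀ (L M : ℕ) [NeZero L] [NeZero M], klEngL₄ P R β U ≤ L → klEngM₃ β U L ≤ M →
      ∀ n : ℕ, 1 ≤ n → n ≤ nScales β + 1 → IsKLRegime U cc (-(n : ℤ)) →
      HistP klPredsV17F2 L M klEngGeo14 P Q R β U μ 0 n →
      (∀ m, 1 ≤ m → m < n → FlowPieceOscAt L M (klReadOscC P R) β U μ m) →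
      FrameOK R U (nScales β) μ (klFlowFrameU L M β U μ n) →
      (∀ j ≤ n, LevelsUExportMixedAt L M (klCU2 P R (klEngQ7 P R)) P β U μ j) →
      ∀ i, 1 ≤ i → i ≤ n → ∀ (q : Fin 6) (w : SpaceTimeIdx L M × SectorLeg (sectorCount (i - 1))),
        klWtPinnedSumOf L M β μ (klFlowFrameU L M β U μ n) (i - 1) 6 (klEffectiveAction L M β U μ (klFlowFrameU L M β U μ n) klE0 i) q w ≤
          S₆ * epsCoupling P U i ^ 2 * (2 : ℝ) ^ (4 * i)) :
    ∀ (P : SplitConsts) (R : RenConsts), P.WF → R.WF2 →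
      ∃ s₂u s₂c s₄ S₆ : ℝ, 0 ≤ s₂u ∧ 0 ≤ s₂c ∧ 0 ≤ s₄ ∧ 0 ≤ S₆ ∧ ∃ cE UE : ℝ, 0 < cE ∧ 0 < UE ∧
      ∀ (Q : EngConsts) (cc : ℝ), 0 < cc → cc ≤ klEngC₃6 P R → cc ≤ cE →
      ∀ μ ∈ klWindowC, ∀ U : ℝ, 0 < U → U ≤ klEngU₀10 P R cc → U ≤ UE →
      ∀ β : ℝ, klBetaMin ≤ β → β ≤ Real.exp (cc / U ^ 2) →
      ∀ (L M : ℕ) [NeZero L] [NeZero M], klEngL₄ P R β U ≤ L → klEngM₃ β U L ≤ M →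
      ∀ n : ℕ, 1 ≤ n → n ≤ nScales β + 1 → IsKLRegime U cc (-(n : ℤ)) →
      HistP klPredsV17F2 L M klEngGeo14 P Q R β U μ 0 n →
      (∀ m, 1 ≤ m → m < n → FlowPieceOscAt L M (klReadOscC P R) β U μ m) →
      FrameOK R U (nScales β) μ (klFlowFrameU L M β U μ n) →
      (∀ j ≤ n, LevelsUExportMixedAt L M (klCU2 P R (klEngQ7 P R)) P β U μ j) →
      (∀ i, 1 ≤ i → i ≤ n → ∀ (q : Fin 2) (w : SpaceTimeIdx L M × SectorLeg (sectorCount (i - 1))),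
        klWtPinnedSumOf L M β μ (klFlowFrameU L M β U μ n) (i - 1) 2 (klEffectiveAction L M β U μ (klFlowFrameU L M β U μ n) klE0 i) q w ≤
          (s₂u * |U| + s₂c * cc) * ((4 : ℝ) ^ (i - 1))⁻¹) ∧
      (∀ i, 1 ≤ i → i ≤ n → ∀ (q : Fin 4) (τ' : Fin 4 → SectorLeg 1) (y' : SpaceTimeIdx L M),
        imagTimeWeight β M ^ 3 * ∑ x' ∈ univ.filter (fun x' : Fin 4 → SpaceTimeIdx L M => x' q = y'),
          klScaleWt L M β i ((univ.image x').image (fun x : SpaceTimeIdx L M => (((((2 * (x.1 : ℕ) : ℕ)) : ZMod (2 * (2 * M)))), x.2))) *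
            ‖sectorisedKernel L M β (trivialMultiplier L M) (klEffectiveAction L M β U μ (klFlowFrameU L M β U μ n) klE0 i) 4 τ' x'‖ ≤ s₄ * epsCoupling P U i) ∧
      (∀ i, 1 ≤ i → i ≤ n → ∀ (q : Fin 6) (w : SpaceTimeIdx L M × SectorLeg (sectorCount (i - 1))),
        klWtPinnedSumOf L M β μ (klFlowFrameU L M β U μ n) (i - 1) 6 (klEffectiveAction L M β U μ (klFlowFrameU L M β U μ n) klE0 i) q w ≤
          S₆ * epsCoupling P U i ^ 2 * (2 : ℝ) ^ (4 * i)) := by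
  intro P R hP hR
  obtain ⟨s₂u, s₂c, hs₂u, hs₂c, cE₂, UE₂, hcE₂, hUE₂, h2⟩ := hE2 P R hP hR
  obtain ⟨s₄, hs₄, cE₄, UE₄, hcE₄, hUE₄, h4⟩ := hE4 P R hP hR
  obtain ⟨S₆, hS₆, cE₆, UE₆, hcE₆, hUE₆, h6⟩ := hE6 P R hP hR
  refine ⟨s₂u, s₂c, s₄, S₆, hs₂u, hs₂c, hs₄, hS₆, min cE₂ (min cE₄ cE₆), min UE₂ (min UE₄ UE₆), lt_min hcE₂ (lt_min hcE₄ hcE₆),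
    lt_min hUE₂ (lt_min hUE₄ hUE₆), ?_⟩
  intro Q cc hcc hcc6 hcE μ hμ U hU hU10 hUE β hβ hβc L M _ _ hL hM n hn1 hn hreg hhist hosc hfr hlev
  refine ⟨?_, ?_, ?_⟩
  · exact h2 Q cc hcc hcc6 (hcE.trans (min_le_left _ _)) μ hμ U hU hU10 (hUE.trans (min_le_left _ _)) β hβ hβc L M hL hM n hn1 hn hreg hhist
      hosc hfr hlev
  · exact h4 Q cc hcc hcc6 (hcE.trans ((min_le_right _ _).trans (min_le_left _ _))) μ hμ U hU hU10
      (hUE.trans ((min_le_right _ _).trans (min_le_left _ _))) β hβ hβc L M hL hM n hn1 hn hreg hhist hosc hfr hlev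
  · exact h6 Q cc hcc hcc6 (hcE.trans ((min_le_right _ _).trans (min_le_right _ _))) μ hμ U hU hU10
      (hUE.trans ((min_le_right _ _).trans (min_le_right _ _))) β hβ hβc L M hL hM n hn1 hn hreg hhist hosc hfr hlev

/-! ## §2 The (E4) family from momentum representations, level by level -/

/-- **THE (E4) FAMILY FROM LEVEL-BY-LEVEL MOMENTUM REPRESENTATIONS**: if under `hE₁`'s binders, at every level `1 ≤ i ≤ n`, the degree-4 momentum kernel of
`𝒱_i[Kₙ]` on the Cooper pattern `(ψ⁺↑, ψ⁺↓, ψ⁻↑, ψ⁻↓)` is `Σ_{l∈S} amp_l·κ·[k̄₀+k̄₁ = k̄₂+k̄₃]·bump_l(−(k̄₀+k̄₁)) + ρ` with (T1w) bump data at rates `≥ (Λ_iβ/(2M), Λ_i)`,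
`klScaleWt_i`-weighted remainder line `≤ r` and `2·(ε³·2(‖κ‖(2M·L²)²)·√(6561988608·n₀)·(2M·L²)·Σ‖amp_l‖A_l + r) ≤ s₄·ε_i`, then the (E4) family holds with the same `s₄`
and doors. [cite: BenfattoGiulianiMastropietro2006, §2.3 (2.17), §2.8 (2.81), (2.41a)] -/
theorem hE4_of_momRepLevels
    (hE4mom : ∀ (P : SplitConsts) (R : RenConsts), P.WF → R.WF2 →
      ∃ s₄ : ℝ, 0 ≤ s₄ ∧ ∃ cE UE : ℝ, 0 < cE ∧ 0 < UE ∧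
      ∀ (Q : EngConsts) (cc : ℝ), 0 < cc → cc ≤ klEngC₃6 P R → cc ≤ cE →
      ∀ μ ∈ klWindowC, ∀ U : ℝ, 0 < U → U ≤ klEngU₀10 P R cc → U ≤ UE →
      ∀ β : ℝ, klBetaMin ≤ β → β ≤ Real.exp (cc / U ^ 2) →
      ∀ (L M : ℕ) [NeZero L] [NeZero M], klEngL₄ P R β U ≤ L → klEngM₃ β U L ≤ M →
      ∀ n : ℕ, 1 ≤ n → n ≤ nScales β + 1 → IsKLRegime U cc (-(n : ℤ)) →
      HistP klPredsV17F2 L M klEngGeo14 P Q R β U μ 0 n →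
      (∀ m, 1 ≤ m → m < n → FlowPieceOscAt L M (klReadOscC P R) β U μ m) →
      FrameOK R U (nScales β) μ (klFlowFrameU L M β U μ n) →
      (∀ j ≤ n, LevelsUExportMixedAt L M (klCU2 P R (klEngQ7 P R)) P β U μ j) →
      ∀ i, 1 ≤ i → i ≤ n →
        ∃ (S : Finset ℕ) (amp : ℕ → ℂ) (κ : ℂ) (bump : ℕ → TorusSite 1 (2 * M) × TorusSite 2 L → ℂ) (ρ : (Fin 4 → FreqMomentum L M) → ℂ)
          (s₀ s₁ A : ℕ → ℝ) (Ns : ℕ → ℕ) (n₀ r : ℝ), 0 ≤ n₀ ∧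
          (∀ k : Fin 4 → FreqMomentum L M,
            kernel ℂ (klEffectiveAction L M β U μ (klFlowFrameU L M β U μ n) klE0 i) 4
                (fun l => ((k l, (![0, 1, 0, 1] : Fin 4 → Fin 2) l), (![0, 0, 1, 1] : Fin 4 → Fin 2) l)) =
              ∑ l ∈ S, amp l * (κ * (if ((fun _ : Fin 1 => ((((k 0).1 : ℕ) : ZMod (2 * M)))), (k 0).2) + ((fun _ : Fin 1 => ((((k 1).1 : ℕ) : ZMod (2 * M)))), (k 1).2) = (((fun _ : Fin 1 => ((((k 2).1 : ℕ) : ZMod (2 * M)))), (k 2).2) : TorusSite 1 (2 * M) × TorusSite 2 L) + ((fun _ : Fin 1 => ((((k 3).1 : ℕ) : ZMod (2 * M)))), (k 3).2) then (fun Q => bump l (-Q)) (((fun _ : Fin 1 => ((((k 0).1 : ℕ) : ZMod (2 * M)))), (k 0).2) + ((fun _ : Fin 1 => ((((k 1).1 : ℕ) : ZMod (2 * M)))), (k 1).2)) else 0)) + ρ k) ∧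
          (∀ l ∈ S, 0 < s₀ l) ∧ (∀ l ∈ S, s₀ l ≤ 1) ∧ (∀ l ∈ S, 0 < s₁ l) ∧ (∀ l ∈ S, s₁ l ≤ 1) ∧ (∀ l ∈ S, 0 ≤ A l) ∧
          (∀ l ∈ S, (Ns l : ℝ) ≤ n₀ * (s₀ l * (2 * M : ℕ)) * (s₁ l * L) ^ 2) ∧
          (∀ l ∈ S, (univ.filter fun q => bump l q ≠ 0).card ≤ Ns l) ∧ (∀ l ∈ S, ∀ q, ‖bump l q‖ ≤ A l) ∧
          (∀ l ∈ S, ∀ q, ‖(fwdDiff ((fun _ : Fin 1 => (1 : ZMod (2 * M))), (0 : TorusSite 2 L)))^[3] (bump l) q‖ ≤ A l * (4 / (s₀ l * (2 * M : ℕ))) ^ 3) ∧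
          (∀ l ∈ S, ∀ q (d : Fin 2), ‖(fwdDiff ((0 : TorusSite 1 (2 * M)), (Pi.single d (1 : ZMod L) : TorusSite 2 L)))^[3] (bump l) q‖ ≤
            A l * (4 / (s₁ l * L)) ^ 3) ∧
          (∀ l ∈ S, klScale klE0 i * β / (2 * M) ≤ s₀ l) ∧ (∀ l ∈ S, klScale klE0 i ≤ s₁ l) ∧
          (∀ (q : Fin 4) (y : SpaceTimeIdx L M), imagTimeWeight β M ^ 3 *
            ∑ x ∈ univ.filter (fun x : Fin 4 → SpaceTimeIdx L M => x q = y),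
              klScaleWt L M β i ((univ.image x).image (fun x : SpaceTimeIdx L M => (((((2 * (x.1 : ℕ) : ℕ)) : ZMod (2 * (2 * M)))), x.2))) *
                ‖(fun (Ω : Fin 4 → SectorLeg 1) (x : Fin 4 → SpaceTimeIdx L M) =>
                  ∑ k : Fin 4 → FreqMomentum L M, (∏ l, trivialMultiplier L M (Ω l).1.1 (k l) * hubbardPlaneWave L M β (Ω l).2 (k l) (x l)) * ρ k)
                  (fun l : Fin 4 => ((((0 : Fin 1), (![0, 1, 0, 1] : Fin 4 → Fin 2) l) : Fin 1 × Fin 2), (![0, 0, 1, 1] : Fin 4 → Fin 2) l)) x‖ ≤ r) ∧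
          2 * (imagTimeWeight β M ^ 3 * (2 * (‖κ‖ * ((((2 * M : ℕ) : ℝ) * (L : ℝ) ^ 2) ^ 2)) *
                (Real.sqrt (6561988608 * n₀) * (((2 * M : ℕ) : ℝ) * (L : ℝ) ^ 2))) * ∑ l ∈ S, ‖amp l‖ * A l + r) ≤
            s₄ * epsCoupling P U i) :
    ∀ (P : SplitConsts) (R : RenConsts), P.WF → R.WF2 →
      ∃ s₄ : ℝ, 0 ≤ s₄ ∧ ∃ cE UE : ℝ, 0 < cE ∧ 0 < UE ∧
      ∀ (Q : EngConsts) (cc : ℝ), 0 < cc → cc ≤ klEngC₃6 P R → cc ≤ cE →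
      ∀ μ ∈ klWindowC, ∀ U : ℝ, 0 < U → U ≤ klEngU₀10 P R cc → U ≤ UE →
      ∀ β : ℝ, klBetaMin ≤ β → β ≤ Real.exp (cc / U ^ 2) →
      ∀ (L M : ℕ) [NeZero L] [NeZero M], klEngL₄ P R β U ≤ L → klEngM₃ β U L ≤ M →
      ∀ n : ℕ, 1 ≤ n → n ≤ nScales β + 1 → IsKLRegime U cc (-(n : ℤ)) →
      HistP klPredsV17F2 L M klEngGeo14 P Q R β U μ 0 n →
      (∀ m, 1 ≤ m → m < n → FlowPieceOscAt L M (klReadOscC P R) β U μ m) →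
      FrameOK R U (nScales β) μ (klFlowFrameU L M β U μ n) →
      (∀ j ≤ n, LevelsUExportMixedAt L M (klCU2 P R (klEngQ7 P R)) P β U μ j) →
      ∀ i, 1 ≤ i → i ≤ n → ∀ (q : Fin 4) (τ' : Fin 4 → SectorLeg 1) (y' : SpaceTimeIdx L M),
        imagTimeWeight β M ^ 3 * ∑ x' ∈ univ.filter (fun x' : Fin 4 → SpaceTimeIdx L M => x' q = y'),
          klScaleWt L M β i ((univ.image x').image (fun x : SpaceTimeIdx L M => (((((2 * (x.1 : ℕ) : ℕ)) : ZMod (2 * (2 * M)))), x.2))) *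
            ‖sectorisedKernel L M β (trivialMultiplier L M) (klEffectiveAction L M β U μ (klFlowFrameU L M β U μ n) klE0 i) 4 τ' x'‖ ≤ s₄ * epsCoupling P U i := by
  intro P R hP hR
  obtain ⟨s₄, hs₄, cE, UE, hcE0, hUE0, h⟩ := hE4mom P R hP hR
  refine ⟨s₄, hs₄, cE, UE, hcE0, hUE0, ?_⟩
  intro Q cc hcc hcc6 hcE μ hμ U hU hU10 hUE β hβ hβc L M _ _ hL hM n hn1 hn hreg hhist hosc hfr hlev i hi1 hin q τ' y'
  obtain ⟨S, amp, κ, bump, ρ, s₀, s₁, A, Ns, n₀, r, hn₀, hker, hs₀, hs₀1, hs₁, hs₁1, hA, hNs, hsupp, hsup, h₀, h₁, hts₀, hts₁, hr, hclose⟩ :=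
    h Q cc hcc hcc6 hcE μ hμ U hU hU10 hUE β hβ hβc L M hL hM n hn1 hn hreg hhist hosc hfr hlev i hi1 hin
  have hβ0 : 0 < β := KLRegimeSplit.pos_of_klBetaMin_le hβ
  exact (wplainLine_klEffectiveAction_allStrings_of_momentumRepresentation hβ0 U μ (klFlowFrameU L M β U μ n) klE0 i S amp κ bump ρ hker
    s₀ s₁ A Ns hn₀ hs₀ hs₀1 hs₁ hs₁1 hA hNs hsupp hsup h₀ h₁ i hts₀ hts₁ hr τ' q y').trans hclose

/-! ## §3 The capstone -/

/-- **ROW (b) (digest e78dfb33d2f7) FROM FIVE E1-CLASS FAMILIES** — `hE2` (two-leg input cells), `hE4mom` (level-by-level momentum representations of the `↑↓`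
quartic kernel of `𝒱_i[Kₙ]`, ε-currency), `hE6` (six-leg input cells), `hmomRep` (the top-level representation, U-currency; binder #6) and `hincr` (weighted two-leg
slice increments), plus the numerics `a bfun u₀`: `…_of_E1data₄ (hE₁_of_split hE2 (hE4_of_momRepLevels hE4mom) hE6)`.  Nothing here asserts any family, row (b),
any stub of 20437, K3, U₀, the window or superconductivity. [cite: BenfattoGiulianiMastropietro2006, §2.3 (2.17), §2.5-§2.8 (2.52)-(2.84), (2.41a), Lemma 2.5 (2.98), §3 (3.2)-(3.8)] -/
theorem stub_engine_step_norms_of_E1data₅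
    (hE2 : ∀ (P : SplitConsts) (R : RenConsts), P.WF → R.WF2 →
      ∃ s₂u s₂c : ℝ, 0 ≤ s₂u ∧ 0 ≤ s₂c ∧ ∃ cE UE : ℝ, 0 < cE ∧ 0 < UE ∧
      ∀ (Q : EngConsts) (cc : ℝ), 0 < cc → cc ≤ klEngC₃6 P R → cc ≤ cE →
      ∀ μ ∈ klWindowC, ∀ U : ℝ, 0 < U → U ≤ klEngU₀10 P R cc → U ≤ UE →
      ∀ β : ℝ, klBetaMin ≤ β → β ≤ Real.exp (cc / U ^ 2) →
      ∀ (L M : ℕ) [NeZero L] [NeZero M], klEngL₄ P R β U ≤ L → klEngM₃ β U L ≤ M →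
      ∀ n : ℕ, 1 ≤ n → n ≤ nScales β + 1 → IsKLRegime U cc (-(n : ℤ)) →
      HistP klPredsV17F2 L M klEngGeo14 P Q R β U μ 0 n →
      (∀ m, 1 ≤ m → m < n → FlowPieceOscAt L M (klReadOscC P R) β U μ m) →
      FrameOK R U (nScales β) μ (klFlowFrameU L M β U μ n) →
      (∀ j ≤ n, LevelsUExportMixedAt L M (klCU2 P R (klEngQ7 P R)) P β U μ j) →
      ∀ i, 1 ≤ i → i ≤ n → ∀ (q : Fin 2) (w : SpaceTimeIdx L M × SectorLeg (sectorCount (i - 1))),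
        klWtPinnedSumOf L M β μ (klFlowFrameU L M β U μ n) (i - 1) 2 (klEffectiveAction L M β U μ (klFlowFrameU L M β U μ n) klE0 i) q w ≤
          (s₂u * |U| + s₂c * cc) * ((4 : ℝ) ^ (i - 1))⁻¹)
    (hE4mom : ∀ (P : SplitConsts) (R : RenConsts), P.WF → R.WF2 →
      ∃ s₄ : ℝ, 0 ≤ s₄ ∧ ∃ cE UE : ℝ, 0 < cE ∧ 0 < UE ∧
      ∀ (Q : EngConsts) (cc : ℝ), 0 < cc → cc ≤ klEngC₃6 P R → cc ≤ cE →
      ∀ μ ∈ klWindowC, ∀ U : ℝ, 0 < U → U ≤ klEngU₀10 P R cc → U ≤ UE →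
      ∀ β : ℝ, klBetaMin ≤ β → β ≤ Real.exp (cc / U ^ 2) →
      ∀ (L M : ℕ) [NeZero L] [NeZero M], klEngL₄ P R β U ≤ L → klEngM₃ β U L ≤ M →
      ∀ n : ℕ, 1 ≤ n → n ≤ nScales β + 1 → IsKLRegime U cc (-(n : ℤ)) →
      HistP klPredsV17F2 L M klEngGeo14 P Q R β U μ 0 n →
      (∀ m, 1 ≤ m → m < n → FlowPieceOscAt L M (klReadOscC P R) β U μ m) →
      FrameOK R U (nScales β) μ (klFlowFrameU L M β U μ n) →
      (∀ j ≤ n, LevelsUExportMixedAt L M (klCU2 P R (klEngQ7 P R)) P β U μ j) →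
      ∀ i, 1 ≤ i → i ≤ n →
        ∃ (S : Finset ℕ) (amp : ℕ → ℂ) (κ : ℂ) (bump : ℕ → TorusSite 1 (2 * M) × TorusSite 2 L → ℂ) (ρ : (Fin 4 → FreqMomentum L M) → ℂ)
          (s₀ s₁ A : ℕ → ℝ) (Ns : ℕ → ℕ) (n₀ r : ℝ), 0 ≤ n₀ ∧
          (∀ k : Fin 4 → FreqMomentum L M,
            kernel ℂ (klEffectiveAction L M β U μ (klFlowFrameU L M β U μ n) klE0 i) 4
                (fun l => ((k l, (![0, 1, 0, 1] : Fin 4 → Fin 2) l), (![0, 0, 1, 1] : Fin 4 → Fin 2) l)) =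
              ∑ l ∈ S, amp l * (κ * (if ((fun _ : Fin 1 => ((((k 0).1 : ℕ) : ZMod (2 * M)))), (k 0).2) + ((fun _ : Fin 1 => ((((k 1).1 : ℕ) : ZMod (2 * M)))), (k 1).2) = (((fun _ : Fin 1 => ((((k 2).1 : ℕ) : ZMod (2 * M)))), (k 2).2) : TorusSite 1 (2 * M) × TorusSite 2 L) + ((fun _ : Fin 1 => ((((k 3).1 : ℕ) : ZMod (2 * M)))), (k 3).2) then (fun Q => bump l (-Q)) (((fun _ : Fin 1 => ((((k 0).1 : ℕ) : ZMod (2 * M)))), (k 0).2) + ((fun _ : Fin 1 => ((((k 1).1 : ℕ) : ZMod (2 * M)))), (k 1).2)) else 0)) + ρ k) ∧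
          (∀ l ∈ S, 0 < s₀ l) ∧ (∀ l ∈ S, s₀ l ≤ 1) ∧ (∀ l ∈ S, 0 < s₁ l) ∧ (∀ l ∈ S, s₁ l ≤ 1) ∧ (∀ l ∈ S, 0 ≤ A l) ∧
          (∀ l ∈ S, (Ns l : ℝ) ≤ n₀ * (s₀ l * (2 * M : ℕ)) * (s₁ l * L) ^ 2) ∧
          (∀ l ∈ S, (univ.filter fun q => bump l q ≠ 0).card ≤ Ns l) ∧ (∀ l ∈ S, ∀ q, ‖bump l q‖ ≤ A l) ∧
          (∀ l ∈ S, ∀ q, ‖(fwdDiff ((fun _ : Fin 1 => (1 : ZMod (2 * M))), (0 : TorusSite 2 L)))^[3] (bump l) q‖ ≤ A l * (4 / (s₀ l * (2 * M : ℕ))) ^ 3) ∧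
          (∀ l ∈ S, ∀ q (d : Fin 2), ‖(fwdDiff ((0 : TorusSite 1 (2 * M)), (Pi.single d (1 : ZMod L) : TorusSite 2 L)))^[3] (bump l) q‖ ≤
            A l * (4 / (s₁ l * L)) ^ 3) ∧
          (∀ l ∈ S, klScale klE0 i * β / (2 * M) ≤ s₀ l) ∧ (∀ l ∈ S, klScale klE0 i ≤ s₁ l) ∧
          (∀ (q : Fin 4) (y : SpaceTimeIdx L M), imagTimeWeight β M ^ 3 *
            ∑ x ∈ univ.filter (fun x : Fin 4 → SpaceTimeIdx L M => x q = y),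
              klScaleWt L M β i ((univ.image x).image (fun x : SpaceTimeIdx L M => (((((2 * (x.1 : ℕ) : ℕ)) : ZMod (2 * (2 * M)))), x.2))) *
                ‖(fun (Ω : Fin 4 → SectorLeg 1) (x : Fin 4 → SpaceTimeIdx L M) =>
                  ∑ k : Fin 4 → FreqMomentum L M, (∏ l, trivialMultiplier L M (Ω l).1.1 (k l) * hubbardPlaneWave L M β (Ω l).2 (k l) (x l)) * ρ k)
                  (fun l : Fin 4 => ((((0 : Fin 1), (![0, 1, 0, 1] : Fin 4 → Fin 2) l) : Fin 1 × Fin 2), (![0, 0, 1, 1] : Fin 4 → Fin 2) l)) x‖ ≤ r) ∧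
          2 * (imagTimeWeight β M ^ 3 * (2 * (‖κ‖ * ((((2 * M : ℕ) : ℝ) * (L : ℝ) ^ 2) ^ 2)) *
                (Real.sqrt (6561988608 * n₀) * (((2 * M : ℕ) : ℝ) * (L : ℝ) ^ 2))) * ∑ l ∈ S, ‖amp l‖ * A l + r) ≤
            s₄ * epsCoupling P U i)
    (hE6 : ∀ (P : SplitConsts) (R : RenConsts), P.WF → R.WF2 →
      ∃ S₆ : ℝ, 0 ≤ S₆ ∧ ∃ cE UE : ℝ, 0 < cE ∧ 0 < UE ∧
      ∀ (Q : EngConsts) (cc : ℝ), 0 < cc → cc ≤ klEngC₃6 P R → cc ≤ cE →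
      ∀ μ ∈ klWindowC, ∀ U : ℝ, 0 < U → U ≤ klEngU₀10 P R cc → U ≤ UE →
      ∀ β : ℝ, klBetaMin ≤ β → β ≤ Real.exp (cc / U ^ 2) →
      ∀ (L M : ℕ) [NeZero L] [NeZero M], klEngL₄ P R β U ≤ L → klEngM₃ β U L ≤ M →
      ∀ n : ℕ, 1 ≤ n → n ≤ nScales β + 1 → IsKLRegime U cc (-(n : ℤ)) →
      HistP klPredsV17F2 L M klEngGeo14 P Q R β U μ 0 n →
      (∀ m, 1 ≤ m → m < n → FlowPieceOscAt L M (klReadOscC P R) β U μ m) →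
      FrameOK R U (nScales β) μ (klFlowFrameU L M β U μ n) →
      (∀ j ≤ n, LevelsUExportMixedAt L M (klCU2 P R (klEngQ7 P R)) P β U μ j) →
      ∀ i, 1 ≤ i → i ≤ n → ∀ (q : Fin 6) (w : SpaceTimeIdx L M × SectorLeg (sectorCount (i - 1))),
        klWtPinnedSumOf L M β μ (klFlowFrameU L M β U μ n) (i - 1) 6 (klEffectiveAction L M β U μ (klFlowFrameU L M β U μ n) klE0 i) q w ≤
          S₆ * epsCoupling P U i ^ 2 * (2 : ℝ) ^ (4 * i))
    {a : ℝ} (ha : 0 ≤ a) {bfun u₀ : GeoConsts → SplitConsts → RenConsts → EngConsts → ℝ → ℝ}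
    (hb : ∀ G P R Q cc, 0 ≤ bfun G P R Q cc) (hu₀ : ∀ G P R Q cc, 0 < u₀ G P R Q cc)
    (hmomRep : ∀ (G : GeoConsts), G.WF → ∀ (P : SplitConsts) (R : RenConsts) (Q : EngConsts) (cc : ℝ), P.WF → R.WF2 → Q.WF → 0 < cc →
      cc ≤ klEngC₃6 P R → ∀ μ ∈ klWindowC, ∀ U : ℝ, 0 < U → U ≤ u₀ G P R Q cc →
      ∀ β : ℝ, klBetaMin ≤ β → β ≤ Real.exp (cc / U ^ 2) →
      ∀ (L M : ℕ) [NeZero L] [NeZero M], klEngL₃ β U ≤ L → klEngM₃ β U L ≤ M →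
      ∀ n : ℕ, 1 ≤ n → n ≤ nScales β + 1 → IsKLRegime U cc (-(n : ℤ)) →
        HistP klPredsV17F2 L M G P Q R β U μ 0 n → FrameOK R U (nScales β) μ (klFlowFrameU L M β U μ n) →
        ∃ (S : Finset ℕ) (amp : ℕ → ℂ) (κ : ℂ) (bump : ℕ → TorusSite 1 (2 * M) × TorusSite 2 L → ℂ) (ρ : (Fin 4 → FreqMomentum L M) → ℂ)
          (s₀ s₁ A : ℕ → ℝ) (Ns : ℕ → ℕ) (n₀ r : ℝ), 0 ≤ n₀ ∧
          (∀ k : Fin 4 → FreqMomentum L M,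
            kernel ℂ (klEffectiveAction L M β U μ (klFlowFrameU L M β U μ n) klE0 n) 4
                (fun i => ((k i, (![0, 1, 0, 1] : Fin 4 → Fin 2) i), (![0, 0, 1, 1] : Fin 4 → Fin 2) i)) =
              ∑ i ∈ S, amp i * (κ * (if ((fun _ : Fin 1 => ((((k 0).1 : ℕ) : ZMod (2 * M)))), (k 0).2) + ((fun _ : Fin 1 => ((((k 1).1 : ℕ) : ZMod (2 * M)))), (k 1).2) = (((fun _ : Fin 1 => ((((k 2).1 : ℕ) : ZMod (2 * M)))), (k 2).2) : TorusSite 1 (2 * M) × TorusSite 2 L) + ((fun _ : Fin 1 => ((((k 3).1 : ℕ) : ZMod (2 * M)))), (k 3).2) then (fun Q => bump i (-Q)) (((fun _ : Fin 1 => ((((k 0).1 : ℕ) : ZMod (2 * M)))), (k 0).2) + ((fun _ : Fin 1 => ((((k 1).1 : ℕ) : ZMod (2 * M)))), (k 1).2)) else 0)) + ρ k) ∧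
          (∀ i ∈ S, 0 < s₀ i) ∧ (∀ i ∈ S, s₀ i ≤ 1) ∧ (∀ i ∈ S, 0 < s₁ i) ∧ (∀ i ∈ S, s₁ i ≤ 1) ∧ (∀ i ∈ S, 0 ≤ A i) ∧
          (∀ i ∈ S, (Ns i : ℝ) ≤ n₀ * (s₀ i * (2 * M : ℕ)) * (s₁ i * L) ^ 2) ∧
          (∀ i ∈ S, (univ.filter fun q => bump i q ≠ 0).card ≤ Ns i) ∧ (∀ i ∈ S, ∀ q, ‖bump i q‖ ≤ A i) ∧
          (∀ i ∈ S, ∀ q, ‖(fwdDiff ((fun _ : Fin 1 => (1 : ZMod (2 * M))), (0 : TorusSite 2 L)))^[3] (bump i) q‖ ≤ A i * (4 / (s₀ i * (2 * M : ℕ))) ^ 3) ∧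
          (∀ i ∈ S, ∀ q (l : Fin 2), ‖(fwdDiff ((0 : TorusSite 1 (2 * M)), (Pi.single l (1 : ZMod L) : TorusSite 2 L)))^[3] (bump i) q‖ ≤
            A i * (4 / (s₁ i * L)) ^ 3) ∧
          (∀ i ∈ S, klScale klE0 n * β / (2 * M) ≤ s₀ i) ∧ (∀ i ∈ S, klScale klE0 n ≤ s₁ i) ∧
          (∀ (q : Fin 4) (y : SpaceTimeIdx L M), imagTimeWeight β M ^ 3 *
            ∑ x ∈ univ.filter (fun x : Fin 4 → SpaceTimeIdx L M => x q = y),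
              klScaleWt L M β n ((univ.image x).image (fun x : SpaceTimeIdx L M => (((((2 * (x.1 : ℕ) : ℕ)) : ZMod (2 * (2 * M)))), x.2))) *
                ‖(fun (Ω : Fin 4 → SectorLeg 1) (x : Fin 4 → SpaceTimeIdx L M) =>
                  ∑ k : Fin 4 → FreqMomentum L M, (∏ i, trivialMultiplier L M (Ω i).1.1 (k i) * hubbardPlaneWave L M β (Ω i).2 (k i) (x i)) * ρ k)
                  (fun i : Fin 4 => ((((0 : Fin 1), (![0, 1, 0, 1] : Fin 4 → Fin 2) i) : Fin 1 × Fin 2), (![0, 0, 1, 1] : Fin 4 → Fin 2) i)) x‖ ≤ r) ∧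
          2 * (imagTimeWeight β M ^ 3 * (2 * (‖κ‖ * ((((2 * M : ℕ) : ℝ) * (L : ℝ) ^ 2) ^ 2)) *
                (Real.sqrt (6561988608 * n₀) * (((2 * M : ℕ) : ℝ) * (L : ℝ) ^ 2))) * ∑ i ∈ S, ‖amp i‖ * A i + r) ≤
            klE0 * (a * |U| + bfun G P R Q cc * (P.Klam * U) ^ 2))
    (hincr : ∀ (P : SplitConsts) (R : RenConsts), P.WF → R.WF2 →
      ∃ Bw : ℝ, 0 ≤ Bw ∧ ∃ uI : EngConsts → ℝ → ℝ, (∀ Q cc, 0 < uI Q cc) ∧ ∃ cI : ℝ, 0 < cI ∧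
      ∀ Q : EngConsts, (klEngQ7 P R).IsRaiseOf Q →
      ∀ cc : ℝ, 0 < cc → cc ≤ klEngC₃6 P R → cc ≤ cI →
      ∀ μ ∈ klWindowC, ∀ U : ℝ, 0 < U → U ≤ klEngU₀10 P R cc → U ≤ uI Q cc →
      ∀ β : ℝ, klBetaMin ≤ β → β ≤ Real.exp (cc / U ^ 2) →
      ∀ (L M : ℕ) [NeZero L] [NeZero M], klEngL₄ P R β U ≤ L → klEngM₃ β U L ≤ M →
      ∀ n : ℕ, 1 ≤ n → n ≤ nScales β + 1 →
        HistP klPredsV17F2 L M klEngGeo14 P Q R β U μ 0 n → FrameOK R U (nScales β) μ (klFlowFrameU L M β U μ n) →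
        ∃ b : ℕ → ℝ, (∑ j ∈ range n, (klScale klE0 (j + 1))⁻¹ * b j ≤ Bw) ∧
          ∀ j < n, ∀ w : GridLeg (GridPoint L (2 * (2 * M))),
            ∑ Y ∈ univ.filter (fun Y : Fin 2 → GridLeg (GridPoint L (2 * (2 * M))) => Y 0 = w),
              klScaleWt L M β (j + 1) ((univ.image Y).image gridLegPos) *
                ‖kernel ℂ
                  (effAction ℂ ((hubbardGridSub L M β (2 * (2 * M))).transpose *
                      hubbardCovAboveCT L M β μ 0 (klFlowFrameU L M β U μ n) (klScale klE0 (j + 1)) * hubbardGridSub L M β (2 * (2 * M)))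
                    (hubbardGridInteraction L (2 * (2 * M)) β U + hubbardGridCounterQuadratic L (2 * (2 * M)) β (klFlowFrameU L M β U μ n)) -
                  effAction ℂ ((hubbardGridSub L M β (2 * (2 * M))).transpose *
                      hubbardCovAboveCT L M β μ 0 (klFlowFrameU L M β U μ n) (klScale klE0 j) * hubbardGridSub L M β (2 * (2 * M)))
                    (hubbardGridInteraction L (2 * (2 * M)) β U + hubbardGridCounterQuadratic L (2 * (2 * M)) β (klFlowFrameU L M β U μ n))) 2 Y‖ ≤
              b j * U ^ 2 * (β / (2 * ((2 * (2 * M) : ℕ) : ℝ)))) :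
    ∀ (P : SplitConsts) (R : RenConsts) (c : ℝ), P.WF → R.WF2 → 0 < c → c ≤ klEngC₃7GU klEngGeo14 P R →
      ∀ μ ∈ klWindowC, ∀ U : ℝ, 0 < U → U ≤ klEngU₀12GQ klEngGeo14 (klEngQ9dG klEngGeo14 P R) P R c → ∀ β : ℝ, klBetaMin ≤ β → β ≤ Real.exp (c / U ^ 2) →
        ∀ (L M : ℕ) [NeZero L] [NeZero M], klEngL₄ P R β U ≤ L → klEngM₃ β U L ≤ M →
          ∀ n : ℕ, 1 ≤ n → n ≤ nScales β + 1 → IsKLRegime U c (-(n : ℤ)) →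
            HistP klPredsV17F2 L M klEngGeo14 P (klEngQ9dG klEngGeo14 P R) R β U μ 0 n →
              (∀ m, 1 ≤ m → m < n → FlowPieceOscAt L M (klReadOscC P R) β U μ m) →
              FrameOK R U (nScales β) μ (klFlowFrameU L M β U μ n) →
                (∀ j ≤ n, LevelsUExportMixedAt L M (klCU2 P R (klEngQ7 P R)) P β U μ j) →
                  KernelNormsV4 L M P (klEngQ9dG klEngGeo14 P R) β U μ (klFlowFrameU L M β U μ n) n ∧
                    (∀ j ≤ n, (KernelNormsLevels L M P (klEngQ9dG klEngGeo14 P R) β U μ (klFlowFrameU L M β U μ n) j ∧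
                      KernelNormsWt4 L M (klWtBudget P (klEngQ9dG klEngGeo14 P R) U j) β U μ (klFlowFrameU L M β U μ n) j)) ∧
                    EngineFirstMoments L M klEngGeo14 P (klEngQ9dG klEngGeo14 P R) β U μ (klFlowFrameU L M β U μ n) n ∧
                    IsoFirstMomentsAt L M klIsoMomC (klIsoMomD P R) P β U μ n ∧
                    TwoLegGridFlowMomentsAtC L M (klZtG klEngGeo14 P R) (klZs1G klEngGeo14 P R) (klZs2G klEngGeo14 P R) c β U μ n  :=
  stub_engine_step_norms_of_E1data₄ (hE₁_of_split hE2 (hE4_of_momRepLevels hE4mom) hE6) ha hb hu₀ hmomRep hincr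

end Summit.HubbardSuperconductivity.HubbardSuperconductivity.Theorems.EngineV8.A24a1G14

end
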